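import Mathlib
import HarnessLib
import Summits.Ventures.LatticeQCDFlow.Exactness.SphereFlowResidualAction
import Summits.Ventures.LatticeQCDFlow.Exactness.SphereLOMapTransportDefect

/-!
# The exact leading-order flow of the E–S action as an uncorrected sampler: its effective action is `cS₀ − ∫_0^c u·V₀(Φ_{0→u}y) du`, its importance weights against `e^{−cS}π̄` have log-spread at most `(c²/2)·(2κ²/(d−1))·Σ_n(Σ_m‖U_nm‖)²`, and its effective sample size is at least `exp(−(c²/2)·(2κ²/(d−1))·Σ_n(Σ_m‖U_nm‖)²)` of the nominal one

HONEST FRAMING: exact (Metropolis-corrected) sampling algorithms for lattice gauge theory;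
figures of merit are autocorrelation/cost numbers at stated couplings and volumes; no
continuum-physics claim.

Venture `LatticeQCDFlow` (cell pub-lqcd), topic `Exactness`; FANOUT row 7 (`s0-cpn-null`: the
S0-D1 rung — 2D CP⁹, Lüscher's LO trivializing map inside HMC, Engel–Schaefer 2011).  NEW WORK of
the cell over the tree's `Exactness/SphereFlowResidualAction.lean` (this leg: the exact reweighting
`∫e^{ℓ_{s→c} − tS∘Φ_{s→c}}H∘Φ_{s→c}dπ̄ = ∫e^{−tS}H dπ̄` and the effective action as the integrated
residual `∫_s^c (S − 𝓛_uG_u)∘Φ_{s→u}du`), `Exactness/SphereLOMapTransportDefect.lean` (GEN-14: the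
E–S residual `𝓛_uS̃⁽⁰⁾ − S = −S₀ + u·V₀`, `0 ≤ V₀ ≤ (2κ²/(d−1))Σ_n(Σ_m‖U_nm‖)²`) and
`Exactness/SphereGradientFlow.lean` (GEN-13: the autonomous flow `sphereGradientFlow`, uniqueness);
nothing is cited as a fact.  Printed counterpart, NAMED ONLY: G. P. Engel, S. Schaefer, Comput.
Phys. Commun. 182 (2011) 2107, §3 eqs. (14)–(18) (the LO map `S̃⁽⁰⁾ = S/(2(d−1))·…` used as the
trivializing map inside HMC); M. Lüscher, Commun. Math. Phys. 293 (2010) 899, §3.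

For the E–S action `S = esAction κ S₀ U` (no self-coupling, adjoint pairs, `d = dim E ≥ 2`) and its
leading-order flow action `S̃⁽⁰⁾ = loFlowAction κ S₀ U`, write `Φ_{0→c}` for the EXACT flow of the
constant generator `S̃⁽⁰⁾` (`sphereTDFlow` of the family `u ↦ S̃⁽⁰⁾`; on `Ω̃` and for `|c| < |T| + 1` it
is GEN-13's autonomous `sphereGradientFlow`, **`sphereTDFlow_const_eq_sphereGradientFlow`**),
`V₀ = (2κ²/(d−1))Σ_n‖p_n‖²` and `M = (2κ²/(d−1))Σ_n(Σ_m‖U_nm‖)²`.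

* §2 **THE EFFECTIVE ACTION OF THE EXACT LO FLOW** (**`effAction_loFlow_eq`**): for `y ∈ Ω̃`,
  `|c| ≤ |T| + 1`: `c·S(Φ_{0→c}y) − ℓ_{0→c}(y) = c·S₀ − ∫_0^c u·V₀(Φ_{0→u}y) du`, hence
  (**`effAction_loFlow_mem_Icc`**) for `0 ≤ c`: `c·S₀ − (c²/2)·M ≤ c·S(Φ_{0→c}y) − ℓ_{0→c}(y) ≤ c·S₀`;
* §3 **THE IMPORTANCE WEIGHTS OF THE UNCORRECTED LO FLOW** `w = exp(ℓ_{0→c} − cS∘Φ_{0→c})`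
  (density of the exact reweighting `∫ w·H∘Φ_{0→c} dπ̄ = ∫ e^{−cS}H dπ̄`,
  **`integral_loWeight_mul_comp_eq`**): `e^{−cS₀} ≤ w ≤ e^{−cS₀ + (c²/2)M}` on `Ω`
  (**`loWeight_mem_Icc`**), so the EFFECTIVE SAMPLE SIZE FRACTION obeys
  `(∫ w dπ̄)² ≥ exp(−(c²/2)·M)·∫ w² dπ̄` (**`sq_integral_loWeight_ge`**): reweighting `y ∼ π̄`,
  `x = Φ_{0→c}(y)` to the target `e^{−cS}π̄/Z_c` costs at most a factor
  `exp((c²/2)·(2κ²/(d−1))·Σ_n(Σ_m‖U_nm‖)²)` in sample size — a bound that is exponential in the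
  VOLUME `|Λ|` at fixed flow time `c` and coupling, and `O(1)` only for `c = O(|Λ|^{−1/2})`.

NOT CLAIMED: a LOWER bound on the weight variance (the barrier direction; only GEN-14's perturbative
sharpness `Var_s(V₀) > 0` exists); anything about the one-step map actually run by the rung (its
Jacobian is GEN-6/GEN-9's `THMC` files); acceptance of the Metropolis-corrected variant;
autocorrelations or the rung's numbers.
-/

noncomputable section

namespace Summit.Ventures.LatticeQCDFlow.Exactness

open Function Set Metric MeasureTheory NormedSpace InnerProductSpace
open scoped RealInnerProductSpace Topology

variable {Λ : Type*} {E : Type*} [NormedAddCommGroup E] [InnerProductSpace ℝ E]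
  [FiniteDimensional ℝ E] [Fintype Λ] [DecidableEq Λ]

/-! ## §1 Constant generators: the time-dependent evolution is the autonomous flow -/

section Const

variable {G₀ : (Λ → E) → ℝ} {T : ℝ}

omit [FiniteDimensional ℝ E] [DecidableEq Λ] in
/-- A constant generator family `u ↦ G₀` is jointly `C^k` when `G₀ ∈ C^k`. -/
theorem contDiff_const_family {k : WithTop ℕ∞} (hG₀ : ContDiff ℝ k G₀) :
    ContDiff ℝ k fun q : ℝ × (Λ → E) => (fun _ : ℝ => G₀) q.1 q.2 := by
  have h := hG₀.comp (contDiff_snd (E := ℝ) (F := Λ → E))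
  exact h

/-- Flow lines are continuous in the time: `t ↦ Φ_{t₀→t}(x)`. -/
theorem continuous_sphereTDFlow_time {G : ℝ → (Λ → E) → ℝ}
    (hG : ContDiff ℝ 2 fun q : ℝ × (Λ → E) => G q.1 q.2) (t₀ : ℝ) (x : Λ → E) :
    Continuous fun t : ℝ => sphereTDFlow hG T t₀ t x := by
  have h1 := (contDiff_sphereTDFlow hG (T := T)).continuous
  have h2 : Continuous fun t : ℝ => ((t₀, t, x) : ℝ × ℝ × (Λ → E)) :=
    continuous_const.prodMk (continuous_id.prodMk continuous_const)
  exact h1.comp h2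

/-- **For a constant generator the evolution maps are GEN-13's autonomous flow**: for `x ∈ Ω̃` and
`|t| < |T| + 1`, `Φ_{0→t}(x) = sphereGradientFlow hG₀ x t` (uniqueness of the true equation
`ẋ = −∂̃G₀(x)` inside the window). -/
theorem sphereTDFlow_const_eq_sphereGradientFlow (hG₀ : ContDiff ℝ 2 G₀) {x : Λ → E}
    (hx : ∀ n, ‖x n‖ = 1) {t : ℝ} (ht : |t| < |T| + 1) :
    sphereTDFlow (G := fun _ : ℝ => G₀) (contDiff_const_family hG₀) T 0 t x =
      sphereGradientFlow hG₀ x t := by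
  have h0 : (0 : ℝ) ∈ Ioo (-(|T| + 1)) (|T| + 1) :=
    ⟨by linarith [abs_nonneg T], by linarith [abs_nonneg T]⟩
  have h := eqOn_sphereGradientFlow hG₀
    (γ := fun t => sphereTDFlow (G := fun _ : ℝ => G₀) (contDiff_const_family hG₀) T 0 t x) h0
    (fun t _ n => norm_sphereTDFlow_eq_one _ 0 hx t n)
    (fun t ht => hasDerivAt_sphereTDFlow _ 0 hx (abs_le.2 ⟨ht.1.le, ht.2.le⟩))
  have h2 := h (show t ∈ Ioo (-(|T| + 1)) (|T| + 1) from ⟨(abs_lt.1 ht).1, (abs_lt.1 ht).2⟩)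
  simp only [sphereTDFlow_self] at h2
  exact h2

end Const

/-! ## §2 The effective action of the exact leading-order flow -/

section LO

variable {U : Λ → Λ → (E →L[ℝ] E)} {T : ℝ}

omit [FiniteDimensional ℝ E] [DecidableEq Λ] in
/-- `x ↦ Σ_n‖p_n(x)‖²` is continuous on the ambient space. -/
theorem continuous_sum_norm_tangentKick_sq (U : Λ → Λ → (E →L[ℝ] E)) :
    Continuous fun x : Λ → E => ∑ n, ‖tangentKick (localField U n x) (x n)‖ ^ 2 := by
  refine continuous_finsetSum _ fun n _ => ?_
  have hJ : Continuous fun x : Λ → E => localField U n x :=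
    (contDiff_localField U n (m := 0)).continuous
  have hx : Continuous fun x : Λ → E => x n := continuous_apply n
  have h : Continuous fun x : Λ → E => tangentKick (localField U n x) (x n) := by
    unfold tangentKick
    exact hJ.sub ((hJ.inner hx).smul hx)
  exact (h.norm).pow 2

/-- **THE RESIDUAL OF THE LO GENERATOR** (GEN-14, read as `S − 𝓛_u S̃⁽⁰⁾`): on `Ω̃`,
`S(x) − 𝓛_uS̃⁽⁰⁾(x) = S₀ − u·V₀(x)`, `V₀ = (2κ²/(d−1))Σ_n‖p_n‖²`. -/
theorem esAction_sub_sphereLuscherL_loFlowAction (hU0 : ∀ n, U n n = 0)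
    (hUadj : ∀ m n (v w : E), ⟪U m n v, w⟫ = ⟪v, U n m w⟫) (hd : 2 ≤ Module.finrank ℝ E)
    (κ S₀ u : ℝ) {x : Λ → E} (hx : ∀ n, ‖x n‖ = 1) :
    esAction κ S₀ U x - sphereLuscherL (esAction κ S₀ U) u (loFlowAction κ S₀ U) x =
      S₀ - u * (2 * κ ^ 2 / ((Module.finrank ℝ E : ℝ) - 1) *
        ∑ n, ‖tangentKick (localField U n x) (x n)‖ ^ 2) := by
  have h := sphereLuscherL_loFlowAction_sub_esAction hU0 hUadj hd κ S₀ u hx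
  linarith

/-- **THE EFFECTIVE ACTION OF THE EXACT LO FLOW.**  For the E–S action (`d ≥ 2`, no self-coupling,
adjoint pairs), `y ∈ Ω̃` and `|c| ≤ |T| + 1`, with `Φ` the exact flow of the constant generator
`S̃⁽⁰⁾`:  `c·S(Φ_{0→c}y) − ℓ_{0→c}(y) = c·S₀ − ∫_0^c u·V₀(Φ_{0→u}y) du`. -/
theorem effAction_loFlow_eq (hU0 : ∀ n, U n n = 0)
    (hUadj : ∀ m n (v w : E), ⟪U m n v, w⟫ = ⟪v, U n m w⟫) (hd : 2 ≤ Module.finrank ℝ E)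
    (κ S₀ : ℝ) {y : Λ → E} (hy : ∀ n, ‖y n‖ = 1) {c : ℝ} (hc : |c| ≤ |T| + 1) :
    c * esAction κ S₀ U (sphereTDFlow (G := fun _ : ℝ => loFlowAction κ S₀ U)
        (contDiff_const_family (contDiff_loFlowAction U κ S₀)) T 0 c y) -
      sphereTDFlowLogJac (G := fun _ : ℝ => loFlowAction κ S₀ U)
        (contDiff_const_family (contDiff_loFlowAction U κ S₀)) T 0 c y =
      c * S₀ - ∫ u in (0 : ℝ)..c, u * (2 * κ ^ 2 / ((Module.finrank ℝ E : ℝ) - 1) *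
        ∑ n, ‖tangentKick (localField U n (sphereTDFlow (G := fun _ : ℝ => loFlowAction κ S₀ U)
          (contDiff_const_family (contDiff_loFlowAction U κ S₀)) T 0 u y))
          (sphereTDFlow (G := fun _ : ℝ => loFlowAction κ S₀ U)
            (contDiff_const_family (contDiff_loFlowAction U κ S₀)) T 0 u y n)‖ ^ 2) := by
  have h0 : |(0 : ℝ)| ≤ |T| + 1 := by rw [abs_zero]; positivity
  have h := mul_action_comp_sub_sphereTDFlowLogJac_eq_intervalIntegral
    (G := fun _ : ℝ => loFlowAction κ S₀ U) (contDiff_const_family (contDiff_loFlowAction U κ S₀))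
    (contDiff_const_family (contDiff_loFlowAction U κ S₀)) (contDiff_esAction U κ S₀) hy h0 hc
    (T := T)
  rw [zero_mul, sub_zero] at h
  rw [h]
  have hV : Continuous fun u : ℝ => u * (2 * κ ^ 2 / ((Module.finrank ℝ E : ℝ) - 1) *
      ∑ n, ‖tangentKick (localField U n (sphereTDFlow (G := fun _ : ℝ => loFlowAction κ S₀ U)
        (contDiff_const_family (contDiff_loFlowAction U κ S₀)) T 0 u y))
        (sphereTDFlow (G := fun _ : ℝ => loFlowAction κ S₀ U)
          (contDiff_const_family (contDiff_loFlowAction U κ S₀)) T 0 u y n)‖ ^ 2) := by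
    have hΦ : Continuous fun u : ℝ => sphereTDFlow (G := fun _ : ℝ => loFlowAction κ S₀ U)
        (contDiff_const_family (contDiff_loFlowAction U κ S₀)) T 0 u y :=
      continuous_sphereTDFlow_time (contDiff_const_family (contDiff_loFlowAction U κ S₀)) 0 y
    have h2 := (continuous_sum_norm_tangentKick_sq U).comp hΦ
    exact continuous_id.mul (continuous_const.mul h2)
  rw [show c * S₀ = ∫ u in (0 : ℝ)..c, S₀ by rw [intervalIntegral.integral_const]; simp,
    ← intervalIntegral.integral_sub intervalIntegrable_const (hV.intervalIntegrable 0 c)]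
  refine intervalIntegral.integral_congr fun u _ => ?_
  exact esAction_sub_sphereLuscherL_loFlowAction hU0 hUadj hd κ S₀ u
    (fun n => norm_sphereTDFlow_eq_one _ 0 hy u n)

/-- **TWO-SIDED BOUND ON THE EFFECTIVE ACTION OF THE EXACT LO FLOW**: for `0 ≤ c ≤ |T| + 1` and
`y ∈ Ω̃`, `c·S₀ − (c²/2)·M ≤ c·S(Φ_{0→c}y) − ℓ_{0→c}(y) ≤ c·S₀`, `M = (2κ²/(d−1))Σ_n(Σ_m‖U_nm‖)²`
(`0 ≤ u·V₀ ≤ u·M` on `[0, c]` and `∫_0^c u du = c²/2`). -/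
theorem effAction_loFlow_mem_Icc (hU0 : ∀ n, U n n = 0)
    (hUadj : ∀ m n (v w : E), ⟪U m n v, w⟫ = ⟪v, U n m w⟫) (hd : 2 ≤ Module.finrank ℝ E)
    (κ S₀ : ℝ) {y : Λ → E} (hy : ∀ n, ‖y n‖ = 1) {c : ℝ} (hc0 : 0 ≤ c) (hc : c ≤ |T| + 1) :
    c * esAction κ S₀ U (sphereTDFlow (G := fun _ : ℝ => loFlowAction κ S₀ U)
        (contDiff_const_family (contDiff_loFlowAction U κ S₀)) T 0 c y) -
      sphereTDFlowLogJac (G := fun _ : ℝ => loFlowAction κ S₀ U)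
        (contDiff_const_family (contDiff_loFlowAction U κ S₀)) T 0 c y ∈
      Icc (c * S₀ - c ^ 2 / 2 * (2 * κ ^ 2 / ((Module.finrank ℝ E : ℝ) - 1) * ∑ n, (∑ m, ‖U n m‖) ^ 2))
        (c * S₀) := by
  have hc' : |c| ≤ |T| + 1 := by rwa [abs_of_nonneg hc0]
  rw [effAction_loFlow_eq hU0 hUadj hd κ S₀ hy hc']
  set M : ℝ := 2 * κ ^ 2 / ((Module.finrank ℝ E : ℝ) - 1) * ∑ n, (∑ m, ‖U n m‖) ^ 2 with hM
  set f : ℝ → ℝ := fun u => u * (2 * κ ^ 2 / ((Module.finrank ℝ E : ℝ) - 1) *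
    ∑ n, ‖tangentKick (localField U n (sphereTDFlow (G := fun _ : ℝ => loFlowAction κ S₀ U)
      (contDiff_const_family (contDiff_loFlowAction U κ S₀)) T 0 u y))
      (sphereTDFlow (G := fun _ : ℝ => loFlowAction κ S₀ U)
        (contDiff_const_family (contDiff_loFlowAction U κ S₀)) T 0 u y n)‖ ^ 2) with hf
  have hfc : Continuous f := by
    have hΦ : Continuous fun u : ℝ => sphereTDFlow (G := fun _ : ℝ => loFlowAction κ S₀ U)
        (contDiff_const_family (contDiff_loFlowAction U κ S₀)) T 0 u y :=
      continuous_sphereTDFlow_time (contDiff_const_family (contDiff_loFlowAction U κ S₀)) 0 y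
    have h2 := (continuous_sum_norm_tangentKick_sq U).comp hΦ
    exact continuous_id.mul (continuous_const.mul h2)
  -- pointwise bounds on `[0, c]`
  have hbd : ∀ u ∈ Icc 0 c, 0 ≤ f u ∧ f u ≤ u * M := by
    intro u hu
    have hyu : ∀ n, ‖sphereTDFlow (G := fun _ : ℝ => loFlowAction κ S₀ U)
        (contDiff_const_family (contDiff_loFlowAction U κ S₀)) T 0 u y n‖ = 1 :=
      fun n => norm_sphereTDFlow_eq_one _ 0 hy u n
    have hV := loCarre_le U hd κ hyu
    exact ⟨mul_nonneg hu.1 hV.1, mul_le_mul_of_nonneg_left hV.2 hu.1⟩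
  have hlow : 0 ≤ ∫ u in (0 : ℝ)..c, f u :=
    intervalIntegral.integral_nonneg hc0 fun u hu => (hbd u hu).1
  have hup : ∫ u in (0 : ℝ)..c, f u ≤ c ^ 2 / 2 * M := by
    have h1 : ∫ u in (0 : ℝ)..c, f u ≤ ∫ u in (0 : ℝ)..c, u * M :=
      intervalIntegral.integral_mono_on hc0 (hfc.intervalIntegrable 0 c)
        ((continuous_id.mul continuous_const).intervalIntegrable 0 c) fun u hu => (hbd u hu).2
    have h2 : ∫ u in (0 : ℝ)..c, u * M = c ^ 2 / 2 * M := by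
      rw [intervalIntegral.integral_mul_const, integral_id]; ring
    linarith
  constructor <;> linarith

end LO

/-! ## §3 The importance weights and the effective sample size of the uncorrected LO flow -/

section Weights

variable [MeasurableSpace E] [BorelSpace E] [Nontrivial E] {U : Λ → Λ → (E →L[ℝ] E)} {T : ℝ}

/-- **THE UNCORRECTED LO FLOW REWEIGHTS EXACTLY**: with `w(ω) = exp(ℓ_{0→c}(ω) − c·S(Φ_{0→c}ω))` and
`|c| ≤ |T| + 1`, `∫ w·H∘Φ_{0→c} dπ̄ = ∫ e^{−cS}H dπ̄` for every `C¹` observable (the exact flow of the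
constant generator `S̃⁽⁰⁾`; no hypothesis on the couplings). -/
theorem integral_loWeight_mul_comp_eq (κ S₀ : ℝ) {H : (Λ → E) → ℝ} (hH : ContDiff ℝ 1 H)
    {c : ℝ} (hc : |c| ≤ |T| + 1) :
    ∫ ω, Real.exp (sphereTDFlowLogJac (G := fun _ : ℝ => loFlowAction κ S₀ U)
        (contDiff_const_family (contDiff_loFlowAction U κ S₀)) T 0 c
          (fun m => ((ω : Λ → sphere (0 : E) 1) m : E)) -
        c * esAction κ S₀ U (sphereTDFlow (G := fun _ : ℝ => loFlowAction κ S₀ U)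
          (contDiff_const_family (contDiff_loFlowAction U κ S₀)) T 0 c (fun m => (ω m : E)))) *
        H (sphereTDFlow (G := fun _ : ℝ => loFlowAction κ S₀ U)
          (contDiff_const_family (contDiff_loFlowAction U κ S₀)) T 0 c (fun m => (ω m : E)))
          ∂Measure.pi (fun _ : Λ => uniformSphere (volume : Measure E)) =
      ∫ ω, Real.exp (-(c * esAction κ S₀ U (fun m => ((ω : Λ → sphere (0 : E) 1) m : E)))) *
        H (fun m => (ω m : E)) ∂Measure.pi (fun _ : Λ => uniformSphere (volume : Measure E)) :=
  integral_exp_sphereTDFlowLogJac_sub_mul_comp _ (contDiff_const_family (contDiff_loFlowAction U κ S₀))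
    (contDiff_esAction U κ S₀) hH c (by rw [abs_zero]; positivity) hc

omit [MeasurableSpace E] [BorelSpace E] [Nontrivial E] in
/-- **THE IMPORTANCE WEIGHTS ARE PINCHED**: for `0 ≤ c ≤ |T| + 1` and `ω ∈ Ω`,
`e^{−cS₀} ≤ w(ω) ≤ e^{−cS₀ + (c²/2)·M}`, `M = (2κ²/(d−1))Σ_n(Σ_m‖U_nm‖)²`. -/
theorem loWeight_mem_Icc (hU0 : ∀ n, U n n = 0)
    (hUadj : ∀ m n (v w : E), ⟪U m n v, w⟫ = ⟪v, U n m w⟫) (hd : 2 ≤ Module.finrank ℝ E)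
    (κ S₀ : ℝ) {c : ℝ} (hc0 : 0 ≤ c) (hc : c ≤ |T| + 1) (ω : Λ → sphere (0 : E) 1) :
    Real.exp (sphereTDFlowLogJac (G := fun _ : ℝ => loFlowAction κ S₀ U)
        (contDiff_const_family (contDiff_loFlowAction U κ S₀)) T 0 c (fun m => (ω m : E)) -
        c * esAction κ S₀ U (sphereTDFlow (G := fun _ : ℝ => loFlowAction κ S₀ U)
          (contDiff_const_family (contDiff_loFlowAction U κ S₀)) T 0 c (fun m => (ω m : E)))) ∈
      Icc (Real.exp (-(c * S₀)))
        (Real.exp (-(c * S₀) + c ^ 2 / 2 *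
          (2 * κ ^ 2 / ((Module.finrank ℝ E : ℝ) - 1) * ∑ n, (∑ m, ‖U n m‖) ^ 2))) := by
  have h := effAction_loFlow_mem_Icc hU0 hUadj hd κ S₀ (norm_sphereConfig_eq_one ω) hc0 hc (T := T)
  rw [mem_Icc] at h ⊢
  constructor
  · exact Real.exp_le_exp.2 (by linarith [h.2])
  · exact Real.exp_le_exp.2 (by linarith [h.1])

/-- **EFFECTIVE SAMPLE SIZE OF THE UNCORRECTED LO FLOW**: for `0 ≤ c ≤ |T| + 1`,
`exp(−(c²/2)·M)·∫ w² dπ̄ ≤ (∫ w dπ̄)²`, `M = (2κ²/(d−1))Σ_n(Σ_m‖U_nm‖)²` — reweighting the flowed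
uniform samples to `e^{−cS}π̄/Z_c` retains at least the fraction `exp(−(c²/2)M)` of the sample size
(exponentially small in the volume at fixed `c`, order one for `c²·Σ_n(Σ_m‖U_nm‖)² = O(1)`). -/
theorem sq_integral_loWeight_ge (hU0 : ∀ n, U n n = 0)
    (hUadj : ∀ m n (v w : E), ⟪U m n v, w⟫ = ⟪v, U n m w⟫) (hd : 2 ≤ Module.finrank ℝ E)
    (κ S₀ : ℝ) {c : ℝ} (hc0 : 0 ≤ c) (hc : c ≤ |T| + 1) :
    Real.exp (-(c ^ 2 / 2 * (2 * κ ^ 2 / ((Module.finrank ℝ E : ℝ) - 1) * ∑ n, (∑ m, ‖U n m‖) ^ 2))) *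
        ∫ ω, Real.exp (sphereTDFlowLogJac (G := fun _ : ℝ => loFlowAction κ S₀ U)
          (contDiff_const_family (contDiff_loFlowAction U κ S₀)) T 0 c
            (fun m => ((ω : Λ → sphere (0 : E) 1) m : E)) -
          c * esAction κ S₀ U (sphereTDFlow (G := fun _ : ℝ => loFlowAction κ S₀ U)
            (contDiff_const_family (contDiff_loFlowAction U κ S₀)) T 0 c (fun m => (ω m : E)))) ^ 2
          ∂Measure.pi (fun _ : Λ => uniformSphere (volume : Measure E)) ≤
      (∫ ω, Real.exp (sphereTDFlowLogJac (G := fun _ : ℝ => loFlowAction κ S₀ U)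
          (contDiff_const_family (contDiff_loFlowAction U κ S₀)) T 0 c
            (fun m => ((ω : Λ → sphere (0 : E) 1) m : E)) -
          c * esAction κ S₀ U (sphereTDFlow (G := fun _ : ℝ => loFlowAction κ S₀ U)
            (contDiff_const_family (contDiff_loFlowAction U κ S₀)) T 0 c (fun m => (ω m : E))))
          ∂Measure.pi (fun _ : Λ => uniformSphere (volume : Measure E))) ^ 2 := by
  set μ : Measure (Λ → sphere (0 : E) 1) := Measure.pi (fun _ : Λ => uniformSphere (volume : Measure E))
    with hμ
  set A : ℝ := Real.exp (-(c * S₀)) with hA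
  set B : ℝ := c ^ 2 / 2 * (2 * κ ^ 2 / ((Module.finrank ℝ E : ℝ) - 1) * ∑ n, (∑ m, ‖U n m‖) ^ 2)
    with hB
  set w : (Λ → sphere (0 : E) 1) → ℝ := fun ω =>
    Real.exp (sphereTDFlowLogJac (G := fun _ : ℝ => loFlowAction κ S₀ U)
      (contDiff_const_family (contDiff_loFlowAction U κ S₀)) T 0 c (fun m => (ω m : E)) -
      c * esAction κ S₀ U (sphereTDFlow (G := fun _ : ℝ => loFlowAction κ S₀ U)
        (contDiff_const_family (contDiff_loFlowAction U κ S₀)) T 0 c (fun m => (ω m : E)))) with hw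
  -- continuity and the pointwise pinching `A ≤ w ≤ A e^B`
  have hwc : Continuous w := by
    have h1 := ((contDiff_sphereTDFlowLogJac_apply (G := fun _ : ℝ => loFlowAction κ S₀ U)
      (contDiff_const_family (contDiff_loFlowAction U κ S₀))
      (contDiff_const_family (contDiff_loFlowAction U κ S₀)) 0 c (T := T)).continuous).comp
      continuous_sphereConfig
    have h2 := (((contDiff_esAction U κ S₀ (m := 1)).comp (contDiff_sphereTDFlow_apply
      (G := fun _ : ℝ => loFlowAction κ S₀ U) (contDiff_const_family (contDiff_loFlowAction U κ S₀))
      0 c (T := T))).continuous).comp continuous_sphereConfig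
    exact Real.continuous_exp.comp (h1.sub (continuous_const.mul h2))
  have hpinch : ∀ ω, A ≤ w ω ∧ w ω ≤ A * Real.exp B := by
    intro ω
    have h := loWeight_mem_Icc hU0 hUadj hd κ S₀ hc0 hc ω (T := T)
    rw [mem_Icc, Real.exp_add] at h
    exact h
  have hApos : 0 < A := Real.exp_pos _
  have hwpos : ∀ ω, 0 < w ω := fun ω => Real.exp_pos _
  have hiw : Integrable w μ := integrable_pi_of_continuous _ hwc
  have hiw2 : Integrable (fun ω => w ω ^ 2) μ := integrable_pi_of_continuous _ (hwc.pow 2)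
  -- `∫ w ≥ A` and `∫ w² ≤ A e^B ∫ w`
  have hI1 : A ≤ ∫ ω, w ω ∂μ := by
    have h := integral_mono (integrable_const A) hiw fun ω => (hpinch ω).1
    simp only [integral_const, smul_eq_mul, hμ, probReal_univ, one_mul] at h
    exact h
  have hI2 : ∫ ω, w ω ^ 2 ∂μ ≤ A * Real.exp B * ∫ ω, w ω ∂μ := by
    rw [← integral_const_mul]
    refine integral_mono hiw2 (hiw.const_mul _) fun ω => ?_
    have h1 := (hpinch ω).2
    have h2 := (hwpos ω).le
    nlinarith
  have hIpos : 0 ≤ ∫ ω, w ω ∂μ := le_trans hApos.le hI1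
  -- combine: e^{−B} ∫w² ≤ e^{−B} A e^B ∫w = A ∫w ≤ (∫w)²
  have hexpB : Real.exp (-B) * (A * Real.exp B) = A := by
    rw [Real.exp_neg]; field_simp
  calc Real.exp (-B) * ∫ ω, w ω ^ 2 ∂μ
      ≤ Real.exp (-B) * (A * Real.exp B * ∫ ω, w ω ∂μ) :=
        mul_le_mul_of_nonneg_left hI2 (Real.exp_pos _).le
    _ = A * ∫ ω, w ω ∂μ := by rw [← mul_assoc, hexpB]
    _ ≤ (∫ ω, w ω ∂μ) * ∫ ω, w ω ∂μ := mul_le_mul_of_nonneg_right hI1 hIpos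
    _ = (∫ ω, w ω ∂μ) ^ 2 := by ring

end Weights

end Summit.Ventures.LatticeQCDFlow.Exactness

end
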